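import Summits.QuantumFields.YangMills.Theorems.LangevinControlUVOSLegsAtWeakCouplingCSketchPencil
import Summits.QuantumFields.YangMills.Theorems.LangevinControlUVOSLegsAtWeakCouplingCSketchKernelDecay
import Summits.QuantumFields.YangMills.Theorems.PencilRigidityCurvatureKernelBoundKernelConclusionOfWitnessLocalDecay
import HarnessLib

/-!
# Crux `OSLegsAtWeakCouplingC` (stmt-QuantumFields-16207), line `Sketch`: E1 from TWO `PencilRigidity` items — `CurvatureKernelBound` discharged

Support file (continuation lead c4).  The landed bridge `osLegsAtWeakCouplingC_of_outputs_pencil` (…SketchPencil, p136895)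
derives the crux from the two output-level imports E0′ (`MomentBounds6`), NT (`LowerBounds`) and THREE items of route
`PencilRigidity`.  One of them, `CurvatureKernelBound` (stmt-QuantumFields-11687, rated open-problem there because the
package `W₁` carries no UV datum), is REDUNDANT along the soft bundles of this line: the E0′ import is exactly the missing UV
datum.  The landed `stub_density`, with its constant exposed (`offDiagDensity_quant`), gives the two-point local decay of
the bundle limit with `η = 2` (`twoPointLocalDecay_of_bundle`, …SketchKernelDecay), and the landed per-witness theorem of
that crux's line `sixteen-charts-analytic-kernel`, `CurvatureKernel.KernelConclusionOfWitnessLocalDecay` (`W₁` + local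
decay ⇒ a real kernel continuous off `0`, below `|x|^(η−10)`, representing `S₁ 2` on `⁰𝒮`), delivers the conclusion of
`CurvatureKernelBound` for the limit.  Hence

`osLegsAtWeakCouplingC_of_outputs_pencil2 :
   (E0′ import) → (NT import) → DiagonalMirrorRPR → NPointIsotropy → OSLegsAtWeakCouplingC`

— the crux BY NAME from two new imports and TWO existing items, `DiagonalMirrorRPR` (stmt-QuantumFields-10604, M) and
`NPointIsotropy` (stmt-QuantumFields-11686, XL).

Refs: OsterwalderSchrader1973 §4; FrohlichIsraelLiebSimon1978; GlimmJaffe1987 §6.1/§19; JaffeWitten2000 §4/§6.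
-/

set_option autoImplicit false

noncomputable section

open scoped SchwartzMap ComplexConjugate BigOperators
open MeasureTheory Filter Topology
open Literature.MathematicalPhysics.QuantumFieldTheory Literature.MathematicalPhysics.QuantumLattice
open Literature.MathematicalPhysics.AQFT Literature.Probability.LatticeModels
open Summit.QuantumFields.YangMills.Theses.LangevinControlUV (OSLegsAtWeakCouplingC)
open Summit.QuantumFields.YangMills.Theses.PencilRigidity (DiagonalMirrorRPR NPointIsotropy)
open Summit.QuantumFields.YangMills.Cruxes.OSLegsFromFemtoAndGap.DlrCollarTransfer
open Summit.QuantumFields.YangMills.Theorems.OSLegsFromFemtoAndGap (isHermitian_of_isReflectionPositive)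
open Summit.QuantumFields.YangMills.Theorems.HypercubicLimit.Negative (onlySpecies extendByZero)
open Summit.QuantumFields.YangMills.Theorems.NPointIsotropy.Negative (E4)
open Summit.QuantumFields.YangMills.Theorems.KernelTransfer (kernelTransfer_proof)
open Summit.QuantumFields.YangMills.Cruxes.ShellRigidity.TransverseSmearingPlanarThreshold (ShellRigidity_proof)
open Summit.QuantumFields.YangMills.Theorems.CurvatureChannel (isReflectionPositive_comp_axisFrame)
open Summit.QuantumFields.YangMills.Theorems.CurvatureKernel (KernelConclusionOfWitnessLocalDecay)

namespace Summit.QuantumFields.YangMills.Cruxes.OSLegsAtWeakCouplingC.Sketch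

/-- **The crux from E0′, NT and TWO items of route `PencilRigidity`** (conditional result): `OSLegsAtWeakCouplingC` BY
NAME from the two output-level hypothesis-side imports of line `Sketch` and the items `DiagonalMirrorRPR` (stmt-10604) and
`NPointIsotropy` (stmt-11686), verbatim; the third item of `osLegsAtWeakCouplingC_of_outputs_pencil`, `CurvatureKernelBound`,
is discharged along the bundle by `twoPointLocalDecay_of_bundle` + the landed `KernelConclusionOfWitnessLocalDecay`. -/
theorem osLegsAtWeakCouplingC_of_outputs_pencil2
    (hMB : ∀ (G : Type) [Group G] [TopologicalSpace G] [IsTopologicalGroup G] [CompactSpace G]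
      [MeasurableSpace G] [BorelSpace G], IsCompactSimpleLieGroup G →
      ∀ (r : LatticeRep G) (a : ℝ → ℝ), Continuous a → TwoPoint G r a → Skewness G r a → GapInUnits G r a →
        MomentBounds6 G r a)
    (hLB : ∀ (G : Type) [Group G] [TopologicalSpace G] [IsTopologicalGroup G] [CompactSpace G]
      [MeasurableSpace G] [BorelSpace G], IsCompactSimpleLieGroup G →
      ∀ (r : LatticeRep G) (a : ℝ → ℝ), Continuous a → TwoPoint G r a → Skewness G r a → GapInUnits G r a →
        LowerBounds G r a)
    (hDiag : DiagonalMirrorRPR) (hNP : NPointIsotropy) :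
    OSLegsAtWeakCouplingC := by
  rw [cruxC_iff]
  intro G _ _ _ _ hG
  letI : MeasurableSpace G := borel G
  haveI : BorelSpace G := ⟨rfl⟩
  intro r a ha h1 h2 h3
  -- positivity and the limit of the unit map, from H1
  obtain ⟨-, -, -, -, -, -, -, hapos, ha0, -, -⟩ := id h1
  -- hypothesis side: the two output-level imports
  have hMB6 : MomentBounds6 G r a := hMB G hG r a ha h1 h2 h3
  have hLB' : LowerBounds G r a := hLB G hG r a ha h1 h2 h3
  -- the rope's demands, then the soft bundle meeting them
  obtain ⟨b₀, g, Δ, hΔ, hRD⟩ := stub_rope G r a hapos ha0 h3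
  obtain ⟨sch, S₁, Tq, K, hB⟩ := stub_growth G r a hapos ha0 hMB6 hLB' h3 b₀ g
  obtain ⟨hRP, hDec⟩ := hRD sch S₁ Tq K hB
  have hsigned : ∀ R : E4 ≃ₗᵢ[ℝ] E4, IsSignedPerm R → Invariant S₁ R :=
    fun R hR n F hF => stub_hypercubic G r a sch S₁ Tq K b₀ g hB n R hR F hF
  -- the two-point local decay of the limit, from the E0′ import (before the bundle is unpacked)
  have hDecay := twoPointLocalDecay_of_bundle r a sch S₁ Tq K b₀ g hMB6 hB
  -- unpack the bundle
  obtain ⟨⟨hunits, -, -, hβ, hN, hLG, hE3, htrans, h0, h1', -, -, hYM, hnt, hng, ⟨Δ', hΔ', hlat⟩, -⟩, -⟩ := hB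
  -- continuum side, everything but rotations
  obtain ⟨hCS, hgapOf⟩ := stub_gap S₁ h0 htrans hRP
  have hE4 : S₁.toLabelled.HasClusterProperty :=
    stub_cluster S₁ Δ hΔ h0 h1' htrans (fun n R hR F hF => hsigned R hR n F hF) hCS hDec
  have hE2 : S₁.toLabelled.IsReflectionPositive := isReflectionPositive_of_rpPos hRP
  have hherm : S₁.toLabelled.IsHermitian := isHermitian_of_isReflectionPositive S₁ hN hE2
  have hgap : S₁.toLabelled.HasMassGap Δ := hgapOf Δ hΔ hDec
  have hhypDet : ∀ R : E4 ≃ₗᵢ[ℝ] E4, LinearMap.det (R.toLinearEquiv : E4 →ₗ[ℝ] E4) = 1 →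
      (∀ i : Fin 4, ∃ j : Fin 4, R (EuclideanSpace.single i 1) = EuclideanSpace.single j 1 ∨
        R (EuclideanSpace.single i 1) = -EuclideanSpace.single j 1) →
      ∀ (n : ℕ) (F : 𝓢((Fin n → E4), ℂ)), IsOffDiagonal F → S₁ n (linActMulti R F) = S₁ n F :=
    fun R _ hR n F hF => hsigned R hR n F hF
  -- the one-species package `W₁` of route `PencilRigidity`, at the common gap rate `min Δ Δ'`
  have hΔ₀ : 0 < min Δ Δ' := lt_min hΔ hΔ'
  have hgap₀ : S₁.toLabelled.HasMassGap (min Δ Δ') := hasMassGap_anti hgap (min_le_left _ _)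
  have hlat₀ : HasLatticeMassGap r sch (min Δ Δ') := hasLatticeMassGap_anti r sch hlat (min_le_right _ _)
  -- reflection positivity in the eight planar frames: axis frames by signed permutations, diagonal frames by the item
  have h8 : ∀ (R : E4 ≃ₗᵢ[ℝ] E4) (p q : ℝ), p ^ 2 + q ^ 2 = 1 → (p = 0 ∨ q = 0 ∨ p ^ 2 = q ^ 2) →
      R (EuclideanSpace.single 0 1) = p • EuclideanSpace.single 0 1 + q • EuclideanSpace.single 1 1 →
      (SchwingerFamily.toLabelled (fun n => (S₁ n).comp (linActMulti R))).IsReflectionPositive := by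
    intro R p q hpq hcase hR
    rcases hcase with hc | hc | hc
    · exact isReflectionPositive_comp_axisFrame S₁ hE2 hhypDet R p q hpq (Or.inl hc) hR
    · exact isReflectionPositive_comp_axisFrame S₁ hE2 hhypDet R p q hpq (Or.inr hc) hR
    · have hp : p ^ 2 = 1 / 2 := by linarith
      have hq : q ^ 2 = 1 / 2 := by linarith
      exact hDiag G hG r sch S₁ ⟨hYM, ⟨hN, hherm, hLG, hE2, hE3, hE4⟩, htrans, hhypDet, min Δ Δ', hΔ₀, hgap₀, hlat₀⟩
        R p q hp hq hR
  -- UV input, DISCHARGED: the two-point local decay of the bundle limit (E0′) fed to the landed per-witness theorem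
  obtain ⟨Kk, C, η, hη, hcont, hbd, hrep⟩ :=
    KernelConclusionOfWitnessLocalDecay G hG r sch S₁
      ⟨hYM, ⟨hN, hherm, hLG, hE2, hE3, hE4⟩, htrans, hhypDet, min Δ Δ', hΔ₀, hgap₀, hlat₀⟩ hDecay
  -- distribution-level symmetries and the eight frames, moved to the kernel (landed `KernelTransfer`)
  obtain ⟨hB4, hpos0, hposD⟩ := kernelTransfer_proof S₁ Kk hcont hrep hE3 hhypDet h8
  -- mass-shell pencil rigidity (landed `ShellRigidity`): the kernel is O(4)-invariant off the origin
  have hiso := ShellRigidity_proof Kk hcont ⟨C, η, hη, hbd⟩ hB4 hpos0 hposD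
  -- n-point upgrade (the item): planar det-1 invariance on `⁰𝒮`
  have hplanarAll := hNP G hG r sch S₁
    ⟨hYM, ⟨hN, hherm, hLG, hE2, hE3, hE4⟩, htrans, hhypDet, min Δ Δ', hΔ₀, hgap₀, hlat₀⟩ h8 ⟨Kk, hcont, hiso, hrep⟩
  have hplanar : ∀ R : E4 ≃ₗᵢ[ℝ] E4, LinearMap.det (R.toLinearEquiv : E4 →ₗ[ℝ] E4) = 1 → IsPlanar01 R →
      Invariant S₁ R := fun R hdet hR n F hF => hplanarAll R hdet hR.1 hR.2 n F hF
  -- E1 by Givens generation, then the OS axioms of `S₁`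
  have hE1 : S₁.toLabelled.IsEuclideanInvariant := isEuclideanInvariant_of_planarRot S₁ htrans hsigned hplanar
  have hOS : OSAxiomsSchwinger S₁.toLabelled :=
    { normalized := hN, hermitian := hherm, invariant := hE1, reflectionPositive := hE2, symmetric := hE3,
      cluster := hE4, linearGrowth := hLG }
  -- one field extended by zero to all species
  have hnt' : ∃ (F₁ G₁ : 𝓢((Fin 1 → E4), ℂ)) (H₁ : 𝓢((Fin (1 + 1) → E4), ℂ)),
      IsTimeOrdered F₁ ∧ IsTimeOrdered G₁ ∧ IsAppendTensorOf H₁ (osAdjoint F₁) G₁ ∧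
        S₁ (1 + 1) H₁ ≠ S₁ 1 (osAdjoint F₁) * S₁ 1 G₁ := by
    simpa using hnt
  have hng' : ∃ (f g h : 𝓢(E4, ℂ)) (Ffgh : 𝓢((Fin 3 → E4), ℂ)) (Fgh Ffh Ffg : 𝓢((Fin 2 → E4), ℂ))
      (Ff Fg Fh : 𝓢((Fin 1 → E4), ℂ)),
      IsTensorOf Ffgh ![f, g, h] ∧ IsOffDiagonal Ffgh ∧ IsTensorOf Fgh ![g, h] ∧
      IsTensorOf Ffh ![f, h] ∧ IsTensorOf Ffg ![f, g] ∧ IsTensorOf Ff ![f] ∧ IsTensorOf Fg ![g] ∧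
      IsTensorOf Fh ![h] ∧
        S₁ 3 Ffgh - S₁ 1 Ff * S₁ 2 Fgh - S₁ 1 Fg * S₁ 2 Ffh - S₁ 1 Fh * S₁ 2 Ffg +
          2 * (S₁ 1 Ff * S₁ 1 Fg * S₁ 1 Fh) ≠ 0 := by
    simpa using hng
  obtain ⟨T, hYM', hntT, hngT⟩ := exists_osData_of_oneField r sch S₁ hOS hYM hnt' hng'
  exact ⟨onlySpecies sch r.curvature, T, hunits, hβ, hYM', hntT, hngT, Δ', hΔ', hlat⟩

end Summit.QuantumFields.YangMills.Cruxes.OSLegsAtWeakCouplingC.Sketch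

end
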